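import Summits.QuantumFields.YangMills.Theorems.UnitScaleTiltHalvingP1FlatCoreSupplierTopCallBase
import Summits.QuantumFields.YangMills.Theorems.UnitScaleTiltHalvingP1FlatCoreTopStepTorusTraceFree
import Literature.MathematicalPhysics.QuantumFieldTheory.Balaban1983to89.B8Prop5JoinSectELocalRDTraceFree
import HarnessLib

/-!
# `hP1room` PROGRAMME (LEAD-H BOARD v3, «w7-19200: (O1) GO» 2026-08-28T16:39Z), (A-1) STAGE 3b BASE, τ-SIBLING: ★★★ THE TRACE-FREE TOP-STEP CALL FOR THE `K − n = 1`
# MEMBER — ✓`P1FlatCoreTopStepTorus.hFP_kLevel_top_RD_traceFree` (✓p646499, (τ-3)) AT `k = 1` WITH NO LOWER DATUM (`u₁ := 1`, `U₁ := U′`, the chart one-form `A`)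

Route `UnitScaleTilt`, crux K1 child «MinimiserStabilityRegPr» (stmt-QuantumFields-19200), registered stub `stub_halvingStep` (`BirthV10`), text `hP1room ⟸ hSupU(ρ2)`
(✓p641613 ∘ ✓p640588; per site ✓p643656 `HalvingP1FlatCoreSupplierDoor.hSup_of_contentRows`, knit ✓p646003 ∘ ✓p647313 from the top-step call's OUTPUT rows).
Cell `ym3-torus` (HUMAN RULING D-0037: YM₃ on T³ is ladder rung R3 — NOT d = 4, NOT a mass gap, NOT the Clay problem), width seat `ym-ust-19200-w7` gen 5.
`--supports stmt-QuantumFields-19200 --as helper`; THEOREMS ONLY (0 `def`, 0 `sorry`); count-neutral; nothing here claims `core′`, `hP1room`, `hSupU`, the stub, the crux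
or the gap.

WHAT.  ★★★ `topRows_of_preGauge_base_traceFree` — ✓`HalvingP1FlatCoreSupplierTopCallBase.topRows_of_preGauge_base`'s binders VERBATIM (the `K − n = 1` member:
NO lower datum, the base datum `A` Hermitian with `U′ = e^{iηA}`, `η‖A‖ ≤ 2s` on the stars of `Ω₀`, its two windows, the [4] letters at `(1, U₀ := 1)`, the torus blocks
(D)(E) and the top windows at `k := 1`) PLUS the τ-block of ✓`hFP_kLevel_top_RD_traceFree` at `k := 1`: `(τ : 𝔸 →L[ℂ] ℂ)` tracial, the datum row in the form
`hAτ : ∀ x μ, τ (A x μ) = 0` (✓p645784's cutoff one-form is traceless EVERYWHERE; `τ(D*A) = 0` follows by lit ✓`apply_covDivB`), `hRτ hGτ hHτ hthτ` and the torus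
top row `hTopTrace` VERBATIM; the lower family's τ-row `hCτlo` is DISCHARGED here (only `j = 0`, where `C′₀ ≡ 0`, ✓`Cnl_level_zero`).  OUTPUT = ✓p646092∕
✓`topRows_of_datum_traceFree`'s conjuncts at `m + 1 := 1`, `Λs (m+1) := Λs1`, `u₁ := 1`, with `∀ x, τ (λ′ x) = 0` after the support clause — so [R-f] `hlam`
(Hermitian ∧ TRACELESS) closes by `exact` at `τ := trace` for the `K − n = 1` member too, and ✓p647313's displayed `htr` is discharged there.
HONEST SCOPE.  By-name re-run of the base twin through the trace-free socket; every analytic and every τ-row above level `0` stays DISPLAYED; nothing of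
Proposition 5, Theorem 4, `core′` or the stub is proved here.

References: T. Bałaban, CMP **99** (1985) 75–102 [Balaban1985RegularSpaces] (Prop. 5 (1.106)–(1.109) p.94, Thm 4 p.88 («for k = 1»), (1.36) p.82, (1.66)–(1.69) p.88,
(1.112)–(1.125) pp.95–97); CMP **99** (1985) 389–434 [Balaban1985BackgroundPropagators] (Thm 3.1 p.397, (3.25) p.394); CMP **98** (1985) 17–51 [Balaban1985Averaging]
((178)–(179) p.45, (208)–(214) p.50).
-/

set_option autoImplicit false

noncomputable section

open scoped BigOperators
open NormedSpace
open Complex (I)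

namespace Summit.QuantumFields.YangMills.Theorems.HalvingP1FlatCoreSupplierTopCallBaseTraceFree

open Literature.MathematicalPhysics.QuantumFieldTheory.Balaban1983to89
open T4Continuum
open MatrixLog (mlog)
open B7Prop1Explicit (e expUnit val_expUnit U1)
open B7Prop2Explicit (unitaryUnits)
open B7Prop1Local (InBox)
open B7Eq78Linearization (conjR conjR_apply zdBlocking QprimeIter QprimeIter_zero Rbar_zero)
open B7Eq170Flat (cj mlog_exp_of_le)
open B8Ineq130 (tlo thi tlo_apply thi_apply)
open B8Ineq132 (covDerivFwd covDeriv)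
open B8Eq119TwistedAxial (bgT)
open B8Eq184Proof (gaugeExp cfgExp)
open B8Eq182Proof (gAd)
open B8Eq188Proof (frakF3)
open B8Eq140Level (SideTouches)
open B8Eq138LandauZd (covDivB covLap QT)
open B8Eq1117Concrete (XSpace)
open B8Prop5ContractionKLevel (Bd2 Mc Kc)
open B8LambdaSpaceKLevel (wt)
open B8Eq178Averages (Qnl util178)
open B8Eq1123Concrete (Cnl)
open B8Eq191FlatStencils (conjR_unitOne_inv)
open B8Prop5SocketDatum (sideTouches_pair_of_mem sideTouches_of_tower_bond)
open B8SockHFPAssembly (isSelfAdjoint_covDivB)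
open B10Eq27TorusAxialLog (axialT)
open Node00 (coverAt)
open B15Eq112TorusCover (cover)
open LatticeFieldCalculus (siteAvgIter)
open Summit.QuantumFields.YangMills.Theorems.Prop8ChartDoubleBar (dbarIterU)
open Summit.QuantumFields.YangMills.Theorems.P1FlatCoreTopStepTorus (hFP_kLevel_top_RD_traceFree)
open Summit.QuantumFields.YangMills.Theorems.HalvingP1FlatCoreSupplierTopCallBase (Cnl_level_zero inBox_tlo_thi_zero_self)
open B8Prop5JoinSectELocalRDTraceFree (apply_covDivB)

-- `Site` alone could resolve to the torus sites; N05's carriers are `Fin d → ℤ`.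
open B7Prop1Explicit (Site)

/-! ## §1 ★★★ The trace-free top-step call at the base -/

variable {P : Params} {𝔸 : Type*} [CStarAlgebra 𝔸] [Nontrivial 𝔸]

/-- ★★★ **THE TRACE-FREE TOP-STEP CALL FOR THE `K − n = 1` MEMBER** (τ-sibling of ✓`HalvingP1FlatCoreSupplierTopCallBase.topRows_of_preGauge_base`).  See the module
docstring: the base twin's binders VERBATIM plus the τ-block (`τ` tracial, `hAτ`, `hRτ hGτ hHτ hthτ hTopTrace` at `k := 1`); OUTPUT = its seven conjuncts with
`∀ x, τ (λ′ x) = 0` after the support clause.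
[cite: Balaban1985RegularSpaces, Prop. 5 (1.106)-(1.109) p.94, Thm 4 p.88, (1.36) p.82, (1.66)-(1.69) p.88, (1.112)-(1.125) pp.95-97; Balaban1985BackgroundPropagators, Thm 3.1 p.397, (3.25) p.394; Balaban1985Averaging, (208)-(214) p.50] -/
theorem topRows_of_preGauge_base_traceFree (τ : 𝔸 →L[ℂ] ℂ) (hτtr : ∀ x y : 𝔸, τ (x * y) = τ (y * x)) (hd2 : 2 ≤ P.d) (hL : 2 ≤ P.L) {η : ℝ} (hη : 0 < η) (h1P : 1 ≤ P.m + P.K)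
    -- the member's geometry: nested regions, the ONE restriction structure of the `k = 1` member, its tower inside the regions
    {Ω : ℕ → Set (Site P.d)} (hΩ : ∀ j, Ω (j + 1) ⊆ Ω j) {Λs1 : ℕ → Set (Site P.d)}
    (htower : ∀ j, j ≤ 1 → ∀ y ∈ Λs1 j, ∀ x, InBox (tlo P.L y j) (thi P.L y j) x → x ∈ Ω j)
    -- THE BASE DATUM: the pre-gauged field `U′` IS `e^{iηA}` with `A` Hermitian, `η‖A‖ ≤ 2s`, on both bonds `(x, μ)`, `(x − e_μ, μ)` at every `x ∈ Ω₀` (✓p645784's rows)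
    {U' : Site P.d → Fin P.d → 𝔸ˣ} {A : Site P.d → Fin P.d → 𝔸} (hAsa : ∀ x μ, IsSelfAdjoint (A x μ)) (hAτ : ∀ x μ, τ (A x μ) = 0) {s : ℝ} (hs : 0 ≤ s)
    (hArows : ∀ x ∈ Ω 0, ∀ μ : Fin P.d,
      (U' x μ = cfgExp η A x μ ∧ η * ‖A x μ‖ ≤ 2 * s) ∧ (U' (x - e μ) μ = cfgExp η A (x - e μ) μ ∧ η * ‖A (x - e μ) μ‖ ≤ 2 * s))
    -- its two windows (the source rows `hA`∕`hDA` of ✓p636261 at levels `j ≤ 1`) and the JOIN's `cA ≤ 1∕13`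
    {α₄ cA cDA : ℝ} (hα₄ : 0 < α₄) (hcAw : (P.L : ℝ) * (2 * s) ≤ cA) (hcDAw : 4 * (P.d : ℝ) * (P.L : ℝ) ^ 2 * s ≤ cDA) (hcA' : cA ≤ 1 / 13)
    -- the [4] LETTERS at `(1, U₀ := 1)`, displayed as the top step reads them (✓`topRows_of_datum`'s block at `m + 1 := 1`)
    (g Δ : (Site P.d → 𝔸) →ₗ[ℂ] (Site P.d → 𝔸)) (q : (Site P.d → 𝔸) →ₗ[ℂ] (ℕ → Site P.d → 𝔸)) (qs : (ℕ → Site P.d → 𝔸) →ₗ[ℂ] (Site P.d → 𝔸))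
    (Aw c : (ℕ → Site P.d → 𝔸) →ₗ[ℂ] (ℕ → Site P.d → 𝔸))
    (g_rightΩ : ∀ x, ∀ y ∈ Ω 0, (Δ (g x) + qs (Aw (q (g x)))) y = x y)
    (c_range : ∀ f, q (g (g (qs (c (q f))))) = q f)
    (hΔ : ∀ (f : Site P.d → 𝔸), ∀ x ∈ Ω 0, Δ f x = covLap η (1 : Site P.d → Fin P.d → 𝔸ˣ) ((Ω 0).indicator f) x)
    (hqs : ∀ (μ : ℕ → Site P.d → 𝔸), ∀ x ∈ Ω 0, qs μ x = QT P.L 1 Λs1 (1 : Site P.d → Fin P.d → 𝔸ˣ) μ x)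
    (hq : ∀ (f : Site P.d → 𝔸) (j : ℕ), j ≤ 1 → ∀ y ∈ Λs1 j,
      q f j y = QprimeIter (zdBlocking P.d P.L) (bgT P.L (1 : Site P.d → Fin P.d → 𝔸ˣ)) j f y)
    (H' : XSpace P.d 1 𝔸 →ₗ[ℂ] (Site P.d → 𝔸)) {B₀'H B₂' BG BR : ℝ} (hB₀'H : 0 < B₀'H) (hB₂' : 0 ≤ B₂') (hBG : 0 ≤ BG) (hBR : 0 ≤ BR)
    (hH0 : ∀ (X : XSpace P.d 1 𝔸) (x : Site P.d), ‖H' X x‖ ≤ B₀'H * ‖X‖)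
    (hH1 : ∀ j, j ≤ 1 → ∀ (X : XSpace P.d 1 𝔸), ∀ p ∈ {b : Site P.d × Fin P.d | SideTouches (Ω j) b.1 b.2},
      wt P.L η j * ‖covDerivFwd η (1 : Site P.d → Fin P.d → 𝔸ˣ) p.2 (H' X) p.1‖ ≤ B₀'H * ‖X‖)
    (hH2 : ∀ X : XSpace P.d 1 𝔸, Bd2 P.L η 1 Ω (covLap η (1 : Site P.d → Fin P.d → 𝔸ˣ) (H' X)) (B₂' * ‖X‖))
    (hHsupp : ∀ (X : XSpace P.d 1 𝔸) (x : Site P.d), x ∉ Ω 0 → H' X x = 0)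
    (hHequiv : ∀ X Y : XSpace P.d 1 𝔸, (∀ p, Y p = -star (X p)) → ∀ x, H' Y x = -star (H' X x))
    (hQH : ∀ (Y : XSpace P.d 1 𝔸) (j : ℕ) (hj : j ≤ 1) (y : Site P.d), y ∈ Λs1 j →
      QprimeIter (zdBlocking P.d P.L) (bgT P.L (1 : Site P.d → Fin P.d → 𝔸ˣ)) j (H' Y) y = Y (⟨j, Nat.lt_succ_of_le hj⟩, y))
    (hG : ∀ (f : Site P.d → 𝔸) (r : ℝ), 0 ≤ r → Bd2 P.L η 1 Ω f r →
      (∀ x, ‖g f x‖ ≤ BG * r) ∧ ∀ j, j ≤ 1 → ∀ p ∈ {b : Site P.d × Fin P.d | SideTouches (Ω j) b.1 b.2},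
        wt P.L η j * ‖covDerivFwd η (1 : Site P.d → Fin P.d → 𝔸ˣ) p.2 (g f) p.1‖ ≤ BG * r)
    (hGsupp : ∀ (f : Site P.d → 𝔸) (x : Site P.d), x ∉ Ω 0 → g f x = 0)
    (hGreal : ∀ f : Site P.d → 𝔸, (∀ j, j ≤ 1 → ∀ x ∈ Ω j, IsSelfAdjoint (f x)) → ∀ x, IsSelfAdjoint (g f x))
    (hRbd : ∀ (f : Site P.d → 𝔸) (r : ℝ), 0 ≤ r → Bd2 P.L η 1 Ω f r → Bd2 P.L η 1 Ω (f - g (qs (c (q (g f))))) (BR * r))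
    (hRreal : ∀ f : Site P.d → 𝔸, (∀ j, j ≤ 1 → ∀ x ∈ Ω j, IsSelfAdjoint (f x)) →
      ∀ j, j ≤ 1 → ∀ x ∈ Ω j, IsSelfAdjoint ((f - g (qs (c (q (g f))))) x))
    -- the family constants of the top step (no lower family at the base: only nonnegativity) and their windows
    {Cb Cl : ℝ} (hCb : 0 ≤ Cb) (hCl : 0 ≤ Cl) (hCbρ : Cb ≤ α₄ / (2 * B₀'H)) (hClB : Cl * B₀'H ≤ 1 / 2)
    -- (D) the torus side: the effective-gauge tower of the charted iterate, the representative, the target (✓p636261's letters VERBATIM at `k := 1`)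
    (W₁ : GaugeField P 0 𝔸ˣ) (κf : (Literature.MathematicalPhysics.QuantumFieldTheory.Balaban1983to89.Site P 0 → 𝔸) → (i : ℕ) → GaugeTransf P i 𝔸ˣ)
    (rep : Literature.MathematicalPhysics.QuantumFieldTheory.Balaban1983to89.Site P 0 → Site P.d)
    (hrep : ∀ yc ∈ Λs1 1, ∀ x : Site P.d, InBox (tlo P.L yc 1) (thi P.L yc 1) x → rep (cover P x) = x)
    (y₀ : Literature.MathematicalPhysics.QuantumFieldTheory.Balaban1983to89.Site P 1)
    (th : XSpace P.d 1 𝔸) (hτ : B₀'H * ‖th‖ < α₄ / 4) (hth : ∀ p, star (th p) = -th p)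
    (hthk : ∀ yc ∈ Λs1 1, th (⟨1, Nat.lt_succ_self 1⟩, yc) = mlog ((axialT (dbarIterU 1 W₁) y₀ (coverAt P 1 yc) : 𝔸ˣ) : 𝔸))
    (hthlo : ∀ (j : ℕ) (hj : j < 1) (y : Site P.d), y ∈ Λs1 j → th (⟨j, Nat.lt_succ_of_lt hj⟩, y) = 0)
    (haxT : ∀ yc ∈ Λs1 1, ‖((axialT (dbarIterU 1 W₁) y₀ (coverAt P 1 yc) : 𝔸ˣ) : 𝔸) - 1‖ < 1)
    -- the top-step windows at the Sect. E sizes (✓p636261's letters VERBATIM, `B₀' := B₀'H`)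
    (ha₁' : α₄ / 4 + B₀'H * (Cb + ‖th‖) ≤ 1 / 24) (hb₁' : α₄ / 4 + B₀'H * (Cb + ‖th‖) ≤ 1 / 140)
    (hθ : 10 * (α₄ / 4 + B₀'H * (Cb + ‖th‖)) * BR ≤ 1 / 2) (hh₀' : B₀'H * (Cb + ‖th‖) ≤ 3 * α₄ / 4)
    (h103 : BG * Mc P.d BR (α₄ / 4 + B₀'H * (Cb + ‖th‖)) cA (B₂' * (Cb + ‖th‖)) cDA ≤ α₄ / 4)
    (h106 : BG * Kc P.d BR (α₄ / 4 + B₀'H * (Cb + ‖th‖)) cA (B₂' * (Cb + ‖th‖)) cDA (B₂' * (2 * Cl)) (1 + B₀'H * (2 * Cl)) (1 + B₀'H * (2 * Cl))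
      ≤ 1 / 2)
    -- (E) the three top rows in torus letters on the tower box (✓p636261's letters VERBATIM at `k := 1`)
    (hTop121 : ∀ yc ∈ Λs1 1, ∀ l₀ : Literature.MathematicalPhysics.QuantumFieldTheory.Balaban1983to89.Site P 0 → 𝔸,
      (∀ x : Site P.d, InBox (tlo P.L yc 1) (thi P.L yc 1) x → ‖l₀ (cover P x)‖ ≤ α₄) →
      (∀ (x : Site P.d) (κ : Fin P.d), InBox (tlo P.L yc 1) (thi P.L yc 1) x → InBox (tlo P.L yc 1) (thi P.L yc 1) (x + e κ) →
        ‖l₀ (cover P (x + e κ)) - l₀ (cover P x)‖ ≤ α₄ * ((P.L : ℝ) ^ 1)⁻¹) →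
      exp (mlog ((κf l₀ 1 (coverAt P 1 yc) : 𝔸ˣ) : 𝔸)) = ((κf l₀ 1 (coverAt P 1 yc) : 𝔸ˣ) : 𝔸) ∧
        ‖mlog ((κf l₀ 1 (coverAt P 1 yc) : 𝔸ˣ) : 𝔸) - siteAvgIter 1 l₀ (coverAt P 1 yc)‖ ≤ Cb)
    (hTop125 : ∀ yc ∈ Λs1 1, ∀ (l₁ l₂ : Literature.MathematicalPhysics.QuantumFieldTheory.Balaban1983to89.Site P 0 → 𝔸) (r : ℝ), 0 ≤ r →
      (∀ x : Site P.d, InBox (tlo P.L yc 1) (thi P.L yc 1) x → ‖l₁ (cover P x)‖ ≤ α₄) →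
      (∀ (x : Site P.d) (κ : Fin P.d), InBox (tlo P.L yc 1) (thi P.L yc 1) x → InBox (tlo P.L yc 1) (thi P.L yc 1) (x + e κ) →
        ‖l₁ (cover P (x + e κ)) - l₁ (cover P x)‖ ≤ α₄ * ((P.L : ℝ) ^ 1)⁻¹) →
      (∀ x : Site P.d, InBox (tlo P.L yc 1) (thi P.L yc 1) x → ‖l₂ (cover P x)‖ ≤ α₄) →
      (∀ (x : Site P.d) (κ : Fin P.d), InBox (tlo P.L yc 1) (thi P.L yc 1) x → InBox (tlo P.L yc 1) (thi P.L yc 1) (x + e κ) →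
        ‖l₂ (cover P (x + e κ)) - l₂ (cover P x)‖ ≤ α₄ * ((P.L : ℝ) ^ 1)⁻¹) →
      (∀ x : Site P.d, InBox (tlo P.L yc 1) (thi P.L yc 1) x → ‖l₁ (cover P x) - l₂ (cover P x)‖ ≤ r) →
      (∀ (x : Site P.d) (κ : Fin P.d), InBox (tlo P.L yc 1) (thi P.L yc 1) x → InBox (tlo P.L yc 1) (thi P.L yc 1) (x + e κ) →
        ‖(l₁ (cover P (x + e κ)) - l₂ (cover P (x + e κ))) - (l₁ (cover P x) - l₂ (cover P x))‖ ≤ r * ((P.L : ℝ) ^ 1)⁻¹) →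
      ‖(mlog ((κf l₁ 1 (coverAt P 1 yc) : 𝔸ˣ) : 𝔸) - siteAvgIter 1 l₁ (coverAt P 1 yc)) -
          (mlog ((κf l₂ 1 (coverAt P 1 yc) : 𝔸ˣ) : 𝔸) - siteAvgIter 1 l₂ (coverAt P 1 yc))‖ ≤ Cl * r)
    (hTopReal : ∀ yc ∈ Λs1 1, ∀ l₀ : Literature.MathematicalPhysics.QuantumFieldTheory.Balaban1983to89.Site P 0 → 𝔸,
      (∀ x : Site P.d, InBox (tlo P.L yc 1) (thi P.L yc 1) x → ‖l₀ (cover P x)‖ ≤ α₄) →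
      (∀ (x : Site P.d) (κ : Fin P.d), InBox (tlo P.L yc 1) (thi P.L yc 1) x → InBox (tlo P.L yc 1) (thi P.L yc 1) (x + e κ) →
        ‖l₀ (cover P (x + e κ)) - l₀ (cover P x)‖ ≤ α₄ * ((P.L : ℝ) ^ 1)⁻¹) →
      mlog ((κf (fun s => -star (l₀ s)) 1 (coverAt P 1 yc) : 𝔸ˣ) : 𝔸) - siteAvgIter 1 (fun s => -star (l₀ s)) (coverAt P 1 yc) =
        -star (mlog ((κf l₀ 1 (coverAt P 1 yc) : 𝔸ˣ) : 𝔸) - siteAvgIter 1 l₀ (coverAt P 1 yc)))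
    -- (τ) the τ-rows of ✓`hFP_kLevel_top_RD_traceFree` at `k := 1` (the datum row is `hAτ` above; the lower family's τ-row is discharged: `C′₀ ≡ 0`)
    (hRτ : ∀ f : Site P.d → 𝔸, (∀ j, j ≤ 1 → ∀ x ∈ Ω j, τ (f x) = 0) →
      ∀ j, j ≤ 1 → ∀ x ∈ Ω j, τ ((f - g (qs (c (q (g f))))) x) = 0)
    (hGτ : ∀ f : Site P.d → 𝔸, (∀ j, j ≤ 1 → ∀ x ∈ Ω j, τ (f x) = 0) → ∀ x, τ (g f x) = 0)
    (hHτ : ∀ X : XSpace P.d 1 𝔸, (∀ p, τ (X p) = 0) → ∀ x, τ (H' X x) = 0)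
    (hthτ : ∀ p, τ (th p) = 0)
    (hTopTrace : ∀ yc ∈ Λs1 1, ∀ l₀ : Literature.MathematicalPhysics.QuantumFieldTheory.Balaban1983to89.Site P 0 → 𝔸, (∀ s, τ (l₀ s) = 0) →
      (∀ x : Site P.d, InBox (tlo P.L yc 1) (thi P.L yc 1) x → ‖l₀ (cover P x)‖ ≤ α₄) →
      (∀ (x : Site P.d) (κ : Fin P.d), InBox (tlo P.L yc 1) (thi P.L yc 1) x → InBox (tlo P.L yc 1) (thi P.L yc 1) (x + e κ) →
        ‖l₀ (cover P (x + e κ)) - l₀ (cover P x)‖ ≤ α₄ * ((P.L : ℝ) ^ 1)⁻¹) →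
      τ (mlog ((κf l₀ 1 (coverAt P 1 yc) : 𝔸ˣ) : 𝔸) - siteAvgIter 1 l₀ (coverAt P 1 yc)) = 0) :
    ∃ lam : Site P.d → 𝔸, (∀ x, IsSelfAdjoint (lam x)) ∧ (∀ x, x ∉ Ω 0 → lam x = 0) ∧ (∀ x, τ (lam x) = 0) ∧
      (∀ j, j ≤ 1 → ∀ b ∈ {b : Site P.d × Fin P.d | SideTouches (Ω j) b.1 b.2},
        ‖lam b.1‖ ≤ α₄ ∧ wt P.L η j * ‖covDerivFwd η (1 : Site P.d → Fin P.d → 𝔸ˣ) b.2 lam b.1‖ ≤ α₄) ∧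
      (∃ μ : ℕ → Site P.d → 𝔸, ∀ x ∈ Ω 0,
        covLap η (1 : Site P.d → Fin P.d → 𝔸ˣ) ((Ω 0).indicator fun y =>
          covDivB η (1 : Site P.d → Fin P.d → 𝔸ˣ) A y + covLap η (1 : Site P.d → Fin P.d → 𝔸ˣ) lam y +
          ((conjR (gaugeExp lam y)⁻¹ (covDivB η (1 : Site P.d → Fin P.d → 𝔸ˣ) A y) - covDivB η (1 : Site P.d → Fin P.d → 𝔸ˣ) A y) +
            (gAd (covLap η (1 : Site P.d → Fin P.d → 𝔸ˣ) lam y) (lam y) - covLap η (1 : Site P.d → Fin P.d → 𝔸ˣ) lam y) +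
            ∑ μ, frakF3 η (1 : Site P.d → Fin P.d → 𝔸ˣ) lam A y μ)) x = QT P.L 1 Λs1 (1 : Site P.d → Fin P.d → 𝔸ˣ) μ x) ∧
      (∀ j, j < 1 → ∀ y ∈ Λs1 j,
        Qnl P.L (1 : Site P.d → Fin P.d → 𝔸ˣ) (fun x => expUnit (((-I) • lam) x)) (1 : Site P.d → 𝔸ˣ) j y = 0) ∧
      (∀ yc ∈ Λs1 1, κf (((-I) • lam) ∘ rep) 1 (coverAt P 1 yc) = axialT (dbarIterU 1 W₁) y₀ (coverAt P 1 yc)) ∧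
      (∀ x ∈ Ω 0, ∀ μ : Fin P.d,
        wt P.L η 0 * ‖A x μ‖ ≤ cA ∧ wt P.L η 0 * ‖conjR ((1 : Site P.d → Fin P.d → 𝔸ˣ) (x - e μ) μ)⁻¹ (A (x - e μ) μ)‖ ≤ cA) := by
  have hU₀ : ∀ (x : Site P.d) (κ : Fin P.d), (1 : Site P.d → Fin P.d → 𝔸ˣ) x κ ∈ unitaryUnits 𝔸 := fun _ _ => (unitaryUnits 𝔸).one_mem
  have hL1 : 1 ≤ P.L := le_trans (by norm_num) hL
  have hLr : (1 : ℝ) ≤ P.L := by exact_mod_cast hL1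
  have hcA0 : 0 ≤ cA := le_trans (by positivity) hcAw
  have hcDA0 : 0 ≤ cDA := le_trans (by positivity) hcDAw
  have hα₄5 : α₄ ≤ 1 / 5 := by
    have h : 0 ≤ B₀'H * (Cb + ‖th‖) := mul_nonneg hB₀'H.le (add_nonneg hCb (norm_nonneg _))
    linarith
  -- `Ω j ⊆ Ω 0` for `j ≤ 1`
  have hΩ0 : ∀ j, j ≤ 1 → ∀ x ∈ Ω j, x ∈ Ω 0 := by
    intro j hj x hx
    rcases Nat.le_one_iff_eq_zero_or_eq_one.1 hj with rfl | rfl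
    · exact hx
    · exact hΩ 0 hx
  -- the weights at levels `j ≤ 1`: `0 ≤ Lʲη ≤ Lη`
  have hwt : ∀ j, j ≤ 1 → 0 ≤ wt P.L η j ∧ wt P.L η j ≤ (P.L : ℝ) * η := by
    intro j hj
    refine ⟨by unfold wt; positivity, ?_⟩
    unfold wt
    have h : (P.L : ℝ) ^ j ≤ (P.L : ℝ) ^ 1 := pow_le_pow_right₀ hLr hj
    rw [pow_one] at h
    exact mul_le_mul_of_nonneg_right h hη.le
  -- the pointwise sizes `‖A‖ ≤ 2s·η⁻¹` on both bonds at every `x ∈ Ω₀`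
  have hbond : ∀ x ∈ Ω 0, ∀ μ : Fin P.d, ‖A x μ‖ ≤ 2 * s * η⁻¹ ∧ ‖A (x - e μ) μ‖ ≤ 2 * s * η⁻¹ := by
    intro x hx μ
    obtain ⟨⟨-, h1⟩, -, h2⟩ := hArows x hx μ
    rw [le_mul_inv_iff₀ hη, mul_comm, le_mul_inv_iff₀ hη, mul_comm (‖A (x - e μ) μ‖)]
    exact ⟨h1, h2⟩
  have hLs : ((P.L : ℝ) * η) * (2 * s * η⁻¹) = (P.L : ℝ) * (2 * s) := by field_simp
  -- ✓p636261's `hA` at levels `j ≤ 1`: `Lʲη·‖A‖ ≤ Lη·2sη⁻¹ = L·2s ≤ cA` (and `R(1)⁻¹ = id` on the backward bond)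
  have hA' : ∀ j, j ≤ 1 → ∀ x ∈ Ω j, ∀ μ : Fin P.d,
      wt P.L η j * ‖A x μ‖ ≤ cA ∧ wt P.L η j * ‖conjR ((1 : Site P.d → Fin P.d → 𝔸ˣ) (x - e μ) μ)⁻¹ (A (x - e μ) μ)‖ ≤ cA := by
    intro j hj x hx μ
    obtain ⟨hw0, hwL⟩ := hwt j hj
    obtain ⟨h1, h2⟩ := hbond x (hΩ0 j hj x hx) μ
    rw [Pi.one_apply, Pi.one_apply, conjR_unitOne_inv]
    constructor
    · calc wt P.L η j * ‖A x μ‖ ≤ ((P.L : ℝ) * η) * (2 * s * η⁻¹) := mul_le_mul hwL h1 (norm_nonneg _) (by positivity)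
        _ ≤ cA := by rw [hLs]; exact hcAw
    · calc wt P.L η j * ‖A (x - e μ) μ‖ ≤ ((P.L : ℝ) * η) * (2 * s * η⁻¹) := mul_le_mul hwL h2 (norm_nonneg _) (by positivity)
        _ ≤ cA := by rw [hLs]; exact hcAw
  -- ✓p636261's `hDA` at levels `j ≤ 1`: `‖D*_1 A(x)‖ ≤ Σ_μ η⁻¹(‖A(x − e_μ)‖ + ‖A x‖) ≤ 4d·s·η⁻²`, `(Lʲη)²·that ≤ 4dL²s ≤ cDA`
  have hdiv : ∀ x ∈ Ω 0, ‖covDivB η (1 : Site P.d → Fin P.d → 𝔸ˣ) A x‖ ≤ (P.d : ℝ) * (η⁻¹ * (4 * s * η⁻¹)) := by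
    intro x hx
    rw [covDivB]
    refine (norm_sum_le _ _).trans ?_
    have hterm : ∀ μ ∈ (Finset.univ : Finset (Fin P.d)), ‖covDeriv η (1 : Site P.d → Fin P.d → 𝔸ˣ) μ (fun z => A z μ) x‖ ≤ η⁻¹ * (4 * s * η⁻¹) := by
      intro μ _
      obtain ⟨h1, h2⟩ := hbond x hx μ
      rw [covDeriv, Pi.one_apply, Pi.one_apply, conjR_unitOne_inv, norm_smul, norm_inv, Real.norm_eq_abs, abs_of_pos hη]
      refine mul_le_mul_of_nonneg_left ((norm_sub_le _ _).trans ?_) (inv_nonneg.2 hη.le)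
      linarith
    refine (Finset.sum_le_sum hterm).trans ?_
    rw [Finset.sum_const, Finset.card_univ, Fintype.card_fin, nsmul_eq_mul]
  have hDA : Bd2 P.L η 1 Ω (fun y => covDivB η (1 : Site P.d → Fin P.d → 𝔸ˣ) A y) cDA := by
    intro j hj x hx
    obtain ⟨hw0, hwL⟩ := hwt j hj
    have hd := hdiv x (hΩ0 j hj x hx)
    have hw2 : wt P.L η j ^ 2 ≤ ((P.L : ℝ) * η) ^ 2 := pow_le_pow_left₀ hw0 hwL 2
    calc wt P.L η j ^ 2 * ‖covDivB η (1 : Site P.d → Fin P.d → 𝔸ˣ) A x‖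
        ≤ ((P.L : ℝ) * η) ^ 2 * ((P.d : ℝ) * (η⁻¹ * (4 * s * η⁻¹))) := mul_le_mul hw2 hd (norm_nonneg _) (by positivity)
      _ = 4 * (P.d : ℝ) * (P.L : ℝ) ^ 2 * s := by field_simp
      _ ≤ cDA := hcDAw
  have hDAsa : ∀ j, j ≤ 1 → ∀ x ∈ Ω j, IsSelfAdjoint (covDivB η (1 : Site P.d → Fin P.d → 𝔸ˣ) A x) :=
    fun j _ x _ => isSelfAdjoint_covDivB hU₀ hAsa x
  -- the JOIN's bond classes `Eb j := {b ∣ SideTouches (Ω j) b}`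
  have hEbΩ : ∀ j, j ≤ 1 → ∀ x ∈ Ω j, ∀ μ : Fin P.d, (x, μ) ∈ {b : Site P.d × Fin P.d | SideTouches (Ω j) b.1 b.2} ∧
      (x - e μ, μ) ∈ {b : Site P.d × Fin P.d | SideTouches (Ω j) b.1 b.2} := fun j _ x hx μ => sideTouches_pair_of_mem hd2 hx μ
  have hEbT : ∀ j, j ≤ 1 → ∀ y ∈ Λs1 j, ∀ (x : Site P.d) (κ : Fin P.d), InBox (tlo P.L y j) (thi P.L y j) x →
      InBox (tlo P.L y j) (thi P.L y j) (x + e κ) → (x, κ) ∈ {b : Site P.d × Fin P.d | SideTouches (Ω j) b.1 b.2} :=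
    fun j hj y hy x κ hx _ => sideTouches_of_tower_bond hd2 htower hj hy x κ hx
  -- the (C) rows below the top: only `j = 0`, where `C′₀ ≡ 0` (§1)
  have hC0 : ∀ j, j < 1 → ∀ y ∈ Λs1 j, ∀ μ : Site P.d → 𝔸, (∀ x : Site P.d, InBox (tlo P.L y j) (thi P.L y j) x → ‖μ x‖ < α₄) →
      Cnl P.L (1 : Site P.d → Fin P.d → 𝔸ˣ) (1 : Site P.d → 𝔸ˣ)⁻¹ j μ y = 0 := by
    intro j hj y _ μ hb
    have hj0 : j = 0 := by omega
    subst hj0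
    have hμ : ‖μ y‖ ≤ 1 / 5 := ((hb y (inBox_tlo_thi_zero_self P.L y)).le.trans hα₄5)
    exact Cnl_level_zero P.L _ _ μ y hμ
  have hC121lo : ∀ j, j < 1 → ∀ y ∈ Λs1 j, ∀ μ : Site P.d → 𝔸,
      (∀ x : Site P.d, InBox (tlo P.L y j) (thi P.L y j) x → ‖μ x‖ < α₄) →
      (∀ (x : Site P.d) (κ : Fin P.d), InBox (tlo P.L y j) (thi P.L y j) x → InBox (tlo P.L y j) (thi P.L y j) (x + e κ) →
        ‖cj ((1 : Site P.d → Fin P.d → 𝔸ˣ) x κ) (μ (x + e κ)) - μ x‖ < α₄ * ((P.L : ℝ) ^ j)⁻¹) →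
      ‖Cnl P.L (1 : Site P.d → Fin P.d → 𝔸ˣ) (1 : Site P.d → 𝔸ˣ)⁻¹ j μ y‖ ≤ Cb := by
    intro j hj y hy μ hb _
    rw [hC0 j hj y hy μ hb, norm_zero]; exact hCb
  have hC125lo : ∀ j, j < 1 → ∀ y ∈ Λs1 j, ∀ (μ₁ μ₂ : Site P.d → 𝔸) (r : ℝ), 0 ≤ r →
      (∀ x : Site P.d, InBox (tlo P.L y j) (thi P.L y j) x → ‖μ₁ x‖ < α₄) →
      (∀ (x : Site P.d) (κ : Fin P.d), InBox (tlo P.L y j) (thi P.L y j) x → InBox (tlo P.L y j) (thi P.L y j) (x + e κ) →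
        ‖cj ((1 : Site P.d → Fin P.d → 𝔸ˣ) x κ) (μ₁ (x + e κ)) - μ₁ x‖ < α₄ * ((P.L : ℝ) ^ j)⁻¹) →
      (∀ x : Site P.d, InBox (tlo P.L y j) (thi P.L y j) x → ‖μ₂ x‖ < α₄) →
      (∀ (x : Site P.d) (κ : Fin P.d), InBox (tlo P.L y j) (thi P.L y j) x → InBox (tlo P.L y j) (thi P.L y j) (x + e κ) →
        ‖cj ((1 : Site P.d → Fin P.d → 𝔸ˣ) x κ) (μ₂ (x + e κ)) - μ₂ x‖ < α₄ * ((P.L : ℝ) ^ j)⁻¹) →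
      (∀ x : Site P.d, InBox (tlo P.L y j) (thi P.L y j) x → ‖(μ₁ - μ₂) x‖ ≤ r) →
      (∀ (x : Site P.d) (κ : Fin P.d), InBox (tlo P.L y j) (thi P.L y j) x → InBox (tlo P.L y j) (thi P.L y j) (x + e κ) →
        ‖cj ((1 : Site P.d → Fin P.d → 𝔸ˣ) x κ) ((μ₁ - μ₂) (x + e κ)) - (μ₁ - μ₂) x‖ ≤ r * ((P.L : ℝ) ^ j)⁻¹) →
      ‖Cnl P.L (1 : Site P.d → Fin P.d → 𝔸ˣ) (1 : Site P.d → 𝔸ˣ)⁻¹ j μ₁ y - Cnl P.L (1 : Site P.d → Fin P.d → 𝔸ˣ) (1 : Site P.d → 𝔸ˣ)⁻¹ j μ₂ y‖ ≤ Cl * r := by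
    intro j hj y hy μ₁ μ₂ r hr h1b _ h2b _ _ _
    rw [hC0 j hj y hy μ₁ h1b, hC0 j hj y hy μ₂ h2b, sub_self, norm_zero]; positivity
  have hCreallo : ∀ j, j < 1 → ∀ y ∈ Λs1 j, ∀ μ : Site P.d → 𝔸,
      (∀ x : Site P.d, InBox (tlo P.L y j) (thi P.L y j) x → ‖μ x‖ < α₄) →
      (∀ (x : Site P.d) (κ : Fin P.d), InBox (tlo P.L y j) (thi P.L y j) x → InBox (tlo P.L y j) (thi P.L y j) (x + e κ) →
        ‖cj ((1 : Site P.d → Fin P.d → 𝔸ˣ) x κ) (μ (x + e κ)) - μ x‖ < α₄ * ((P.L : ℝ) ^ j)⁻¹) →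
      Cnl P.L (1 : Site P.d → Fin P.d → 𝔸ˣ) (1 : Site P.d → 𝔸ˣ)⁻¹ j (fun x => -star (μ x)) y =
        -star (Cnl P.L (1 : Site P.d → Fin P.d → 𝔸ˣ) (1 : Site P.d → 𝔸ˣ)⁻¹ j μ y) := by
    intro j hj y hy μ hb _
    have hb' : ∀ x : Site P.d, InBox (tlo P.L y j) (thi P.L y j) x → ‖-star (μ x)‖ < α₄ := fun x hx => by
      rw [norm_neg, norm_star]; exact hb x hx
    rw [hC0 j hj y hy μ hb, hC0 j hj y hy (fun x => -star (μ x)) hb', star_zero, neg_zero]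
  -- the τ-rows of the datum and of the (trivial) lower family
  have hDAτ : ∀ j, j ≤ 1 → ∀ x ∈ Ω j, τ (covDivB η (1 : Site P.d → Fin P.d → 𝔸ˣ) A x) = 0 :=
    fun j _ x _ => apply_covDivB τ hτtr _ hAτ x
  have hCτlo : ∀ j, j < 1 → ∀ y ∈ Λs1 j, ∀ μ : Site P.d → 𝔸, (∀ x, τ (μ x) = 0) →
      (∀ x : Site P.d, InBox (tlo P.L y j) (thi P.L y j) x → ‖μ x‖ < α₄) →
      (∀ (x : Site P.d) (κ : Fin P.d), InBox (tlo P.L y j) (thi P.L y j) x → InBox (tlo P.L y j) (thi P.L y j) (x + e κ) →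
        ‖cj ((1 : Site P.d → Fin P.d → 𝔸ˣ) x κ) (μ (x + e κ)) - μ x‖ < α₄ * ((P.L : ℝ) ^ j)⁻¹) →
      τ (Cnl P.L (1 : Site P.d → Fin P.d → 𝔸ˣ) (1 : Site P.d → 𝔸ˣ)⁻¹ j μ y) = 0 := by
    intro j hj y hy μ _ hb _
    rw [hC0 j hj y hy μ hb, map_zero]
  -- THE TRACE-FREE TOP STEP (✓p646499, BY NAME) at `k := 1`, `Λs := Λs1`, `u₁ := 1`
  obtain ⟨lam, hlsa, hloff, hτ0, h108, ⟨μ, hmul⟩, hlo, htopId⟩ := hFP_kLevel_top_RD_traceFree (P := P) (k := 1) (Λs := Λs1)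
    (Eb := fun j => {b : Site P.d × Fin P.d | SideTouches (Ω j) b.1 b.2}) (A := A) h1P hη hEbΩ hEbT g Δ q qs Aw c g_rightΩ c_range hΔ hqs H'
    hα₄ hB₀'H hB₂' hCb hCl hH0 hH1 hH2 hHsupp hHequiv hCbρ hClB hBG hBR hcA0 hcA' hcDA0 hG hGsupp hGreal hRbd hRreal hDA hDAsa hA' hAsa hQH hq
    (1 : Site P.d → 𝔸ˣ) hC121lo hC125lo hCreallo
    W₁ κf rep hrep y₀ th hτ hth hthk hthlo haxT ha₁' hb₁' hθ hh₀' h103 h106 hTop121 hTop125 hTopReal τ hτtr hDAτ hRτ hGτ hHτ hthτ hCτlo hTopTrace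
  refine ⟨lam, hlsa, hloff, hτ0, fun j hj b hb => h108 j hj b hb, ⟨μ, hmul⟩, fun j hj y hy => ?_, htopId, fun x hx μ' => hA' 0 (Nat.zero_le _) x hx μ'⟩
  have h := hlo j hj y hy
  rwa [inv_one] at h

end Summit.QuantumFields.YangMills.Theorems.HalvingP1FlatCoreSupplierTopCallBaseTraceFree

end
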